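import Summits.HodgeConjecture.HodgeConjecture.Theses.LinearSystemTorelli
import Literature.AlgebraicGeometry.HodgeTheory.PencilStepBelowMiddleHolds

/-!
# Route LinearSystemTorelli — `PencilReduction` (item stmt-HodgeConjecture-1083) holds;
# stub `stub_pencil` of line `HodgeEffectivity` for the crux `TranscendentalOrSupported` (stmt-HodgeConjecture-10853)

`PencilReduction` — the Lefschetz-pencil reduction of the Hodge conjecture below the middle degree
(Thomas 2005 Prop. 2; de Cataldo–Migliorini 2009 §4, proof of Prop. 4.5): for `1 ≤ p`, `2p ≤ m`, the
Hodge conjecture in all codimensions for smooth projective `m`-folds and in codimension `p - 1` for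
`(m+1)`-folds imply the Hodge conjecture in codimension `p` for smooth projective `(m+1)`-folds — is a
two-line consequence of the tree's UNCONDITIONAL pencil step
`Literature.AlgebraicGeometry.HodgeTheory.mem_algebraicClasses_of_two_mul_le`
(`HodgeTheory/PencilStepBelowMiddleHolds`, accepted p123843), which needs only the first of the two
Hodge-conjecture hypotheses (the codimension-`p - 1` hypothesis of the item is not used, as the route
reviews of stmt-HodgeConjecture-1083 predicted).

* `linearSystemTorelli_pencilReduction_proof : PencilReduction` — closes route item
  stmt-HodgeConjecture-1083 by name.
* `stub_pencil : PencilReduction` — the registered stub `stub_pencil` of the line `HodgeEffectivity`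
  (crux stmt-HodgeConjecture-10853, `Cruxes/TranscendentalOrSupported/Lines/HodgeEffectivity.lean`),
  verbatim its signature.
-/

noncomputable section

set_option linter.dupNamespace false

open Literature.AlgebraicGeometry.Motives Literature.AlgebraicGeometry.HodgeTheory

namespace Summit.HodgeConjecture.HodgeConjecture.Theorems

/-- **`PencilReduction` holds** (route item stmt-HodgeConjecture-1083): the pencil step below the
middle dimension, `Literature.AlgebraicGeometry.HodgeTheory.mem_algebraicClasses_of_two_mul_le`
(de Cataldo–Migliorini 2009 §4 / Thomas 2005 Prop. 2, proved in the tree), after discarding the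
unused codimension-`p - 1` hypothesis.
[cite: Thomas2005Nodes, §2 Prop. 2] [cite: DecataldoMigliorini2009, §4 Prop. 4.5] -/
theorem linearSystemTorelli_pencilReduction_proof :
    Summit.HodgeConjecture.HodgeConjecture.Theses.LinearSystemTorelli.PencilReduction := by
  intro m p _ hpm hHC _ X hX c hc hpp
  exact mem_algebraicClasses_of_two_mul_le hX hHC p c hpm hc hpp

/-- **Stub `stub_pencil` of line `HodgeEffectivity`** (crux `TranscendentalOrSupported`,
stmt-HodgeConjecture-10853; registered signature = route item `PencilReduction` verbatim): holds by
`linearSystemTorelli_pencilReduction_proof`.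
[cite: Thomas2005Nodes, §2 Prop. 2] [cite: DecataldoMigliorini2009, §4 Prop. 4.5] -/
theorem stub_pencil :
    Summit.HodgeConjecture.HodgeConjecture.Theses.LinearSystemTorelli.PencilReduction :=
  linearSystemTorelli_pencilReduction_proof

end Summit.HodgeConjecture.HodgeConjecture.Theorems

end
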